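import Summits.BirchSwinnertonDyer.BirchSwinnertonDyer.Theorems.ByReductionTypeAtTwoRankOneAtTwoOffBigImageOddLocalArchBoundaryNorm
import Mathlib.Data.ZMod.Basic
import HarnessLib

/-!
# Route `ByReductionTypeAtTwo`, crux `RankOneAtTwoOffBigImageOddLocal` (stmt-BirchSwinnertonDyer-23716), line
# `refined_kolyvagin_tamagawa_shift_at_two`, stub `stub_sigmaShiftPosDisc`: THE REAL COMPONENT OF THE τ-REAL HEEGNER VALUES
# ALONG THE ANTICYCLOTOMIC `ℓ`-TOWER — the vertical distribution relation forces PERIOD TWO (pure algebra, PROVED)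

Lead prover `prover-cruxlead-stmt-BirchSwinnertonDyer-23716-g12` (2026-08-29), `--supports stmt-BirchSwinnertonDyer-23716`
(helper; closes nothing).  THEOREMS ONLY (no definition, no named fact, no `sorry`).  Sequel to
`…OffBigImageOddLocalArchBoundaryNorm.lean` (p687908) / `…ArchBoundaryNormPair.lean` (p688427); companion memo
`Cruxes/RankOneAtTwoOffBigImageOddLocal/ArchBoundaryBitAtTwo.md` v3 (§7: seat `bsd-2adic-kit-3 g1`'s T1/T2 tables integrated).

WHY.  At boundary level `M = M(ℓ)` the archimedean Selmer bit of the `ℚ`-descended Kolyvagin class `d_M(ℓ)` on `{Δ > 0}` is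
(memo §2, kernel p687908) `c = [u odd]·[k₀ even]·λ(σ^{k₀/2} y_ℓ) + [v odd]·[k₀ odd]·λ(y_K)` (`h_K = 1`; `λ` = real-component
character at the `τ`-adapted real place, `σ^{k₀/2} y_ℓ` a `τ`-REAL Heegner value of conductor `ℓ`).  The kit's tables (jobs
j324744/j324896, 747/747 rows) say `λ(σ^{k₀/2} y_ℓ) = λ(y_K)` whenever `ℓ` is an odd inert Kolyvagin prime (`a_ℓ` even) —
«conjecture A∞′».  This file isolates what the RELATIONS OF THE HEEGNER MODULE prove about it at the real place:

* §1 (odd orbits) for `ρ` of ODD order `q = 2h+1` inverted by `τ` (`Gal(K_{ℓ^{n+1}}/K_{ℓ^n})`, `n ≥ 1`, has order `ℓ`) and a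
  `τ`-fixed `z`: `Σ_{i<q} ρ^i • z = z + (Y + τ Y)` — the orbit sum is the point plus a `τ`-NORM; hence the vertical
  distribution relation `Tr_{K_{ℓ^{n+2}}/K_{ℓ^{n+1}}} z_{n+2} = a_ℓ • z_{n+1} − z_n` reads `z_{n+2} + N_τ(Y) = a_ℓ • z_{n+1} − z_n`;
* §2 (real component) for ANY additive `λ : M → A` killing `τ`-norms (`λ(x + τ x) = 0`: the component map
  `E(F_w) → E(ℝ)/E(ℝ)⁰`, norms from `ℂ` land in `E(ℝ)⁰`): `λ z_{n+2} = λ z_n` when `a_ℓ` is even — the real component of the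
  `τ`-real Heegner values has PERIOD TWO up the tower: even layers carry `λ(y_K)`, odd layers carry `λ(σ^{k₀/2} y_ℓ)`;
* §3 (the bottom step is different) for `σ` of EVEN order `m = 2n` with `τ y = σ^{2h} • y`: the full trace is
  `σ^h • y + σ^{h+n} • y + N_τ(Y)` — TWO `τ`-real values —, so `Tr y_ℓ = a_ℓ • y_K` only gives the PAIR equality
  `λ(σ^h y) = λ(σ^{h+n} y)` (the kit's «two square roots agree», 950/950), never `λ(σ^h y) = λ(y_K)`;
* §4 the boundary bit from the root of p687908: `λ R₀ = u • λ(σ^h y) − (m+k₀) • λ t`; under A∞′ and `t ∈ ℤ y_K` it is a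
  multiple of `λ(y_K)`, and `λ(y_K) = 0` as soon as `y_K ∈ 2 E + N_τ E` (the `M₀ ≥ 1` regime): the kit's «c = 0 in all 621
  habitat points with M₀ ≥ 1; c = 1 only at M₀ = 0»;
* §5 a two-element model in which every relation above holds and `λ(layer 1) ≠ λ(layer 0)`: A∞′ is NOT a consequence of the
  trace relations and the real-place formalism — it needs arithmetic input (open; memo §7).

BSD is NOT proved by any of this; the crux is NOT proved; the stub is NOT proved; A∞′ is NOT proved.

References: [GrossLMS1991] B. H. Gross, *Kolyvagin's work on modular elliptic curves*, LMS LNS 153 (1991), §3 Prop. 3.7,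
§5 Prop. 5.3; [Darmon2004] H. Darmon, *Rational Points on Modular Elliptic Curves*, CBMS 101 (2004), Prop. 3.10 (the
distribution relations `Tr P_{nℓ} = a_ℓ P_n − P_{n/ℓ}`); [PerrinRiou1987BSMF] B. Perrin-Riou, Bull. SMF 115 (1987), §3.1;
[McCallumLMS1991] W. G. McCallum, *Kolyvagin's work on Shafarevich–Tate groups*, ibid., §5.
-/

set_option linter.dupNamespace false -- tree convention: `Summit.BirchSwinnertonDyer.BirchSwinnertonDyer.Theorems` (summit = sub-problem)
set_option autoImplicit false

open Finset

namespace Summit.BirchSwinnertonDyer.BirchSwinnertonDyer.Theorems.OffBigImageOddLocalAtTwo.ArchVerticalNorm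

open Summit.BirchSwinnertonDyer.BirchSwinnertonDyer.Theorems.OffBigImageOddLocalAtTwo.ArchBoundaryNorm

/-! ## §1 Odd orbits: the orbit sum of a `τ`-fixed point is the point plus a `τ`-norm -/

section OddOrbit

variable {R : Type*} [CommRing R] {M : Type*} [AddCommGroup M] [Module R M]

/-- The reflection rule with explicit indices: if `τ (σ • x) = σ′ • τ x`, `σ σ′ = 1`, `σ^m = 1` and `τ y = σ^{k₀} • y`,
then `τ (σ^p • y) = σ^r • y` whenever `p + r = k₀ + m` (`τ` reflects the orbit about `k₀/2`, indices mod `m`).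
[cite: GrossLMS1991, Prop. 5.3 (proof)] -/
theorem map_pow_smul_of_add_eq {σ σ' : R} {m k₀ : ℕ} (hσσ' : σ * σ' = 1) (hσ : σ ^ m = 1) (τ : M →+ M)
    (hτ : ∀ x : M, τ (σ • x) = σ' • τ x) {y : M} (hy : τ y = σ ^ k₀ • y) {p r : ℕ} (hpr : p + r = k₀ + m) :
    τ (σ ^ p • y) = σ ^ r • y := by
  rw [map_pow_smul τ hτ, hy, ← mul_smul]
  congr 1
  symm
  calc σ ^ r = σ ^ r * (σ * σ') ^ p := by rw [hσσ', one_pow, mul_one]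
    _ = σ ^ (p + r) * σ' ^ p := by rw [mul_pow, pow_add]; ring
    _ = σ ^ (k₀ + m) * σ' ^ p := by rw [hpr]
    _ = σ' ^ p * σ ^ k₀ := by rw [pow_add, hσ, mul_one, mul_comm]

/-- **ODD ORBIT.**  `ρ ∈ R` with `ρ ρ′ = 1`, `ρ^{2h+1} = 1` (a generator of `Gal(K_{ℓ^{n+1}}/K_{ℓ^n})`, of odd order `ℓ`
for `n ≥ 1`), `τ (ρ • x) = ρ′ • τ x`, and `z` `τ`-FIXED (a `τ`-real Heegner value).  Then
`Σ_{i<2h+1} ρ^i • z = z + (Y + τ Y)` with `Y = Σ_{j<h} ρ^{j+1} • z`: apart from `z` itself the orbit splits into the `h`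
norm pairs `{ρ^{j+1} z, ρ^{2h−j} z = τ(ρ^{j+1} z)}` — an involution without fixed points on a set of EVEN size `2h`.
[cite: GrossLMS1991, Prop. 5.3 (proof)] [cite: Darmon2004, Prop. 3.10] -/
theorem sum_pow_smul_eq_add_norm_of_odd {ρ ρ' : R} {h : ℕ} (hρρ' : ρ * ρ' = 1) (hρ : ρ ^ (2 * h + 1) = 1)
    (τ : M →+ M) (hτ : ∀ x : M, τ (ρ • x) = ρ' • τ x) {z : M} (hz : τ z = z) :
    ∑ i ∈ range (2 * h + 1), ρ ^ i • z =
      z + ((∑ j ∈ range h, ρ ^ (j + 1) • z) + τ (∑ j ∈ range h, ρ ^ (j + 1) • z)) := by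
  have hz' : τ z = ρ ^ 0 • z := by rw [pow_zero, one_smul, hz]
  have hτj : ∀ j ∈ range h, τ (ρ ^ (j + 1) • z) = ρ ^ (h + 1 + (h - 1 - j)) • z := by
    intro j hj
    rw [mem_range] at hj
    exact map_pow_smul_of_add_eq hρρ' hρ τ hτ hz' (by omega)
  rw [map_sum, sum_congr rfl hτj, sum_range_reflect (fun j ↦ ρ ^ (h + 1 + j) • z) h,
    show 2 * h + 1 = (h + 1) + h by ring, sum_range_add, sum_range_succ' (fun j ↦ ρ ^ j • z), pow_zero, one_smul]
  abel

/-- **THE VERTICAL STEP.**  If moreover the vertical distribution relation holds —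
`Σ_{i<2h+1} ρ^i • z₂ = a • z₁ − z₀` (`Tr_{K_{ℓ^{n+2}}/K_{ℓ^{n+1}}} y_{ℓ^{n+2}} = a_ℓ y_{ℓ^{n+1}} − y_{ℓ^n}`, applied to the
`τ`-real values `z_k = g₀^{(k)} y_{ℓ^k}` with compatible square roots `g₀^{(k)}` of `σ₀`) — then
`z₂ + (Y + τ Y) = a • z₁ − z₀`: layer `n+2` is congruent to `a • (layer n+1) − (layer n)` modulo `τ`-NORMS.
[cite: Darmon2004, Prop. 3.10] [cite: PerrinRiou1987BSMF, §3.1] [cite: GrossLMS1991, Prop. 3.7] -/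
theorem add_norm_eq_of_vertical {ρ ρ' : R} {h : ℕ} (hρρ' : ρ * ρ' = 1) (hρ : ρ ^ (2 * h + 1) = 1)
    (τ : M →+ M) (hτ : ∀ x : M, τ (ρ • x) = ρ' • τ x) {z₀ z₁ z₂ : M} (hz₂ : τ z₂ = z₂) {a : ℤ}
    (hvert : ∑ i ∈ range (2 * h + 1), ρ ^ i • z₂ = a • z₁ - z₀) :
    z₂ + ((∑ j ∈ range h, ρ ^ (j + 1) • z₂) + τ (∑ j ∈ range h, ρ ^ (j + 1) • z₂)) = a • z₁ - z₀ := by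
  rw [← sum_pow_smul_eq_add_norm_of_odd hρρ' hρ τ hτ hz₂, hvert]

end OddOrbit

/-! ## §2 The real component: any additive functional killing `τ`-norms has period two up the tower -/

section RealComponent

variable {R : Type*} [CommRing R] {M : Type*} [AddCommGroup M] [Module R M] {A : Type*} [AddCommGroup A]

/-- A functional killing `τ`-norms is `2`-torsion on `τ`-fixed points: `λ (z + τ z) = 0`, `τ z = z` ⟹ `2 • λ z = 0`
(`E(ℝ)/E(ℝ)⁰` has exponent `2`). [folklore] -/
theorem two_smul_apply_eq_zero (τ : M →+ M) (lam : M →+ A) (hlam : ∀ x : M, lam (x + τ x) = 0) {z : M}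
    (hz : τ z = z) : 2 • lam z = 0 := by
  have h := hlam z
  rwa [hz, ← two_smul ℕ z, map_nsmul] at h

/-- … hence it kills EVEN multiples of `τ`-fixed points (`a_ℓ • z` with `2 ∣ a_ℓ`). [folklore] -/
theorem apply_zsmul_eq_zero_of_even (τ : M →+ M) (lam : M →+ A) (hlam : ∀ x : M, lam (x + τ x) = 0) {z : M}
    (hz : τ z = z) {a : ℤ} (ha : Even a) : lam (a • z) = 0 := by
  obtain ⟨b, rfl⟩ := ha
  have hb : (b + b) • z = b • (z + τ z) := by rw [hz, smul_add, add_smul]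
  rw [hb, map_zsmul, hlam, smul_zero]

/-- **LAYER `n+2` HAS THE REAL COMPONENT OF LAYER `n`.**  `ρ` of odd order `2h+1` inverted by `τ`; `z₀, z₁, z₂` `τ`-fixed;
the vertical relation `Σ_{i<2h+1} ρ^i • z₂ = a • z₁ − z₀` with `a` EVEN; `λ` additive killing `τ`-norms.  Then `λ z₂ = λ z₀`.
(For the `τ`-real Heegner values: the value at conductor `ℓ^{n+2}` lies on the real component of the value at conductor `ℓ^n`
whenever `a_ℓ` is even; in particular the conductor-`ℓ²` value lies on the component of `y_K` — UNCONDITIONALLY.)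
[cite: Darmon2004, Prop. 3.10] [cite: GrossLMS1991, Prop. 3.7, Prop. 5.3] -/
theorem apply_layer_two_eq {ρ ρ' : R} {h : ℕ} (hρρ' : ρ * ρ' = 1) (hρ : ρ ^ (2 * h + 1) = 1)
    (τ : M →+ M) (hτ : ∀ x : M, τ (ρ • x) = ρ' • τ x) (lam : M →+ A) (hlam : ∀ x : M, lam (x + τ x) = 0)
    {z₀ z₁ z₂ : M} (hz₀ : τ z₀ = z₀) (hz₁ : τ z₁ = z₁) (hz₂ : τ z₂ = z₂) {a : ℤ} (ha : Even a)
    (hvert : ∑ i ∈ range (2 * h + 1), ρ ^ i • z₂ = a • z₁ - z₀) : lam z₂ = lam z₀ := by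
  have key := congrArg lam (add_norm_eq_of_vertical hρρ' hρ τ hτ hz₂ hvert)
  rw [map_add, hlam, add_zero, map_sub, apply_zsmul_eq_zero_of_even τ lam hlam hz₁ ha, zero_sub] at key
  rw [key, neg_eq_iff_add_eq_zero, ← two_smul ℕ]
  exact two_smul_apply_eq_zero τ lam hlam hz₀

/-- **PERIOD TWO UP THE TOWER.**  If `λ (z (n+2)) = λ (z n)` for every `n` (the previous theorem, layer by layer — the
generator `ρ_n`, its order `ℓ` and the square root `g₀^{(n)}` may vary with `n`), then the even layers carry `λ (z 0)`
(`= λ(y_K)`) and the odd layers carry `λ (z 1)` (`= λ(σ^{k₀/2} y_ℓ)`).  So «A∞′: `λ (z 1) = λ (z 0)`» is the statement that `λ`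
is CONSTANT on the real anticyclotomic `ℓ`-tower, and it is decided at the bottom step alone. [folklore] -/
theorem apply_tower_eq {z : ℕ → M} (lam : M →+ A) (h2 : ∀ n : ℕ, lam (z (n + 2)) = lam (z n)) (k : ℕ) :
    lam (z (2 * k)) = lam (z 0) ∧ lam (z (2 * k + 1)) = lam (z 1) := by
  induction k with
  | zero => simp
  | succ k ih =>
    refine ⟨?_, ?_⟩
    · rw [show 2 * (k + 1) = 2 * k + 2 by ring, h2]; exact ih.1
    · rw [show 2 * (k + 1) + 1 = (2 * k + 1) + 2 by ring, h2]; exact ih.2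

/-- The tower theorem with its hypotheses spelled out: `τ`-fixed values `z n`, generators `ρ n` of odd order `2 h n + 1`
inverted by `τ`, an EVEN `a`, and the vertical relations `Σ_{i<2hn+1} (ρ n)^i • z (n+2) = a • z (n+1) − z n` for all `n`
⟹ `λ (z (2k)) = λ (z 0)` and `λ (z (2k+1)) = λ (z 1)` for all `k`. [cite: Darmon2004, Prop. 3.10] [cite: GrossLMS1991, Prop. 3.7] -/
theorem apply_tower_eq_of_vertical {z : ℕ → M} {ρ ρ' : ℕ → R} {hn : ℕ → ℕ} (τ : M →+ M)
    (hρρ' : ∀ n, ρ n * ρ' n = 1) (hρ : ∀ n, ρ n ^ (2 * hn n + 1) = 1)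
    (hτ : ∀ n (x : M), τ (ρ n • x) = ρ' n • τ x) (lam : M →+ A) (hlam : ∀ x : M, lam (x + τ x) = 0)
    (hz : ∀ n, τ (z n) = z n) {a : ℤ} (ha : Even a)
    (hvert : ∀ n, ∑ i ∈ range (2 * hn n + 1), ρ n ^ i • z (n + 2) = a • z (n + 1) - z n) (k : ℕ) :
    lam (z (2 * k)) = lam (z 0) ∧ lam (z (2 * k + 1)) = lam (z 1) :=
  apply_tower_eq lam
    (fun n ↦ apply_layer_two_eq (hρρ' n) (hρ n) τ (hτ n) lam hlam (hz n) (hz (n + 1)) (hz (n + 2)) ha (hvert n)) k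

end RealComponent

/-! ## §3 The bottom step is different: an EVEN-order orbit carries TWO `τ`-real values -/

section Bottom

variable {R : Type*} [CommRing R] {M : Type*} [AddCommGroup M] [Module R M] {A : Type*} [AddCommGroup A]

/-- **FULL-TRACE PAIRING (even order).**  `σ σ′ = 1`, `σ^{2(n+1)} = 1` (`m = ℓ + 1` even), `τ (σ • x) = σ′ • τ x`,
`τ y = σ^{2h} • y` (`σ₀ = σ^{k₀}` a square, `k₀ = 2h`).  Then
`Σ_{i<2n+2} σ^i • y = σ^h • y + σ^{h+n+1} • y + (Y + τ Y)`, `Y = Σ_{j<n} σ^{h+1+j} • y`: the orbit of `y_ℓ` contains exactly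
TWO `τ`-fixed values, `σ^h y` and `σ^{h+m/2} y` (the two square roots of `σ₀`), the rest being `n` norm pairs.
[cite: GrossLMS1991, Prop. 5.3 (proof)] -/
theorem trace_smul_eq_pair_add_norm {σ σ' : R} {n h : ℕ} (hσσ' : σ * σ' = 1) (hσ : σ ^ (2 * n + 2) = 1)
    (τ : M →+ M) (hτ : ∀ x : M, τ (σ • x) = σ' • τ x) {y : M} (hy : τ y = σ ^ (2 * h) • y) :
    ∑ i ∈ range (2 * n + 2), σ ^ i • y =
      σ ^ h • y + σ ^ (h + n + 1) • y +
        ((∑ j ∈ range n, σ ^ (h + 1 + j) • y) + τ (∑ j ∈ range n, σ ^ (h + 1 + j) • y)) := by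
  -- shift the trace by `σ^h`
  have hshift : ∑ i ∈ range (2 * n + 2), σ ^ i • y = ∑ i ∈ range (2 * n + 2), σ ^ (h + i) • y := by
    symm
    calc ∑ i ∈ range (2 * n + 2), σ ^ (h + i) • y = (σ ^ h * ∑ i ∈ range (2 * n + 2), σ ^ i) • y := by
          rw [mul_sum, sum_smul]
          simp_rw [pow_add]
      _ = ∑ i ∈ range (2 * n + 2), σ ^ i • y := by rw [pow_mul_trace_eq hσ h, sum_smul]
  -- the reflected second half is the conjugate of the first half
  have hτj : ∀ j ∈ range n, τ (σ ^ (h + 1 + j) • y) = σ ^ (h + n + 2 + (n - 1 - j)) • y := by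
    intro j hj
    rw [mem_range] at hj
    exact map_pow_smul_of_add_eq hσσ' hσ τ hτ hy (by omega)
  have e1 : ∑ j ∈ range n, σ ^ (h + (j + 1)) • y = ∑ j ∈ range n, σ ^ (h + 1 + j) • y :=
    sum_congr rfl fun j _ ↦ by rw [show h + (j + 1) = h + 1 + j by ring]
  have e2 : ∑ j ∈ range n, σ ^ (h + (n + 1 + (j + 1))) • y = ∑ j ∈ range n, σ ^ (h + n + 2 + j) • y :=
    sum_congr rfl fun j _ ↦ by rw [show h + (n + 1 + (j + 1)) = h + n + 2 + j by ring]
  rw [hshift, map_sum, sum_congr rfl hτj, sum_range_reflect (fun j ↦ σ ^ (h + n + 2 + j) • y) n,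
    show 2 * n + 2 = (n + 1) + (n + 1) by ring, sum_range_add, sum_range_succ' (fun j ↦ σ ^ (h + j) • y),
    sum_range_succ' (fun j ↦ σ ^ (h + (n + 1 + j)) • y), e1, e2, Nat.add_zero, Nat.add_zero,
    show h + (n + 1) = h + n + 1 by ring]
  abel

/-- **THE PAIR EQUALITY (all the bottom relation gives).**  With `Tr • y = Σ_{i<m} σ^i • y = a • y₀` (`Tr y_ℓ = a_ℓ y_K`),
`a` EVEN, `τ y₀ = y₀`, and `λ` killing `τ`-norms: `λ (σ^h • y) = λ (σ^{h+m/2} • y)` — the two `τ`-real values of conductor `ℓ`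
lie on the SAME real component (kit T2: 950/950), but nothing relates them to `λ y₀`. [cite: GrossLMS1991, Prop. 3.7 (i), Prop. 5.3] -/
theorem apply_pow_half_eq {σ σ' : R} {n h : ℕ} (hσσ' : σ * σ' = 1) (hσ : σ ^ (2 * n + 2) = 1)
    (τ : M →+ M) (hτ : ∀ x : M, τ (σ • x) = σ' • τ x) (lam : M →+ A)
    (hlam : ∀ x : M, lam (x + τ x) = 0) {y y₀ : M} (hy : τ y = σ ^ (2 * h) • y) (hy₀ : τ y₀ = y₀) {a : ℤ}
    (ha : Even a) (htr : ∑ i ∈ range (2 * n + 2), σ ^ i • y = a • y₀) :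
    lam (σ ^ h • y) = lam (σ ^ (h + n + 1) • y) := by
  have hfix : τ (σ ^ h • y) = σ ^ h • y := map_pow_half_smul_eq hσσ' τ hτ hy
  have key := congrArg lam (trace_smul_eq_pair_add_norm hσσ' hσ τ hτ hy)
  rw [htr, apply_zsmul_eq_zero_of_even τ lam hlam hy₀ ha, map_add, map_add, hlam, add_zero] at key
  -- key : 0 = λ(σ^h y) + λ(σ^{h+n+1} y)
  have h2 := two_smul_apply_eq_zero τ lam hlam hfix
  rw [two_smul] at h2
  -- λ a = -λ b and 2 λ a = 0
  have : lam (σ ^ (h + n + 1) • y) = -lam (σ ^ h • y) := eq_neg_of_add_eq_zero_right key.symm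
  rw [this, eq_neg_iff_add_eq_zero, h2]

end Bottom

/-! ## §4 The boundary-level bit read through A∞′ -/

section Boundary

variable {R : Type*} [CommRing R] {M : Type*} [AddCommGroup M] [Module R M] {A : Type*} [AddCommGroup A]

/-- **The bit of the root.**  Under the hypotheses of `ArchBoundaryNorm.root_sub_eq_norm_of_even` (`m = 2^e u`,
`Tr • y = 2^e • t`, `τ y = σ^{2h} • y`, no `2^e`-torsion, `2^e • R₀ = D•y + τ(D•y)`), for `λ` killing `τ`-norms:
`λ R₀ = −(u • λ(σ^h • y)) + (m + 2h) • λ t` — the boundary-level archimedean Selmer bit is carried by ONE `τ`-real Heegner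
value and by `t` (`= (a_ℓ/2^M) y_K` for `h_K = 1`). [cite: McCallumLMS1991, §5] [cite: GrossLMS1991, Prop. 5.3] -/
theorem apply_root_of_even {σ σ' : R} {m h e u : ℕ} (hσσ' : σ * σ' = 1)
    (hσ : σ ^ m = 1) (hm : m = 2 ^ e * u) (τ : M →+ M) (hτ : ∀ x : M, τ (σ • x) = σ' • τ x) {y t R₀ : M}
    (hy : τ y = σ ^ (2 * h) • y) (ht : (∑ i ∈ range m, σ ^ i) • y = ((2 ^ e : ℕ) : R) • t)
    (h2 : ∀ x : M, ((2 ^ e : ℕ) : R) • x = 0 → x = 0)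
    (hR₀ : ((2 ^ e : ℕ) : R) • R₀ =
      (∑ i ∈ range m, (i : R) * σ ^ i) • y + τ ((∑ i ∈ range m, (i : R) * σ ^ i) • y))
    (lam : M →+ A) (hlam : ∀ x : M, lam (x + τ x) = 0) :
    lam R₀ = -(u • lam (σ ^ h • y)) + (m + 2 * h) • lam t := by
  have key := congrArg lam (root_sub_eq_norm_of_even hσσ' hσ hm τ hτ hy ht h2 hR₀)
  rw [hlam, map_sub, map_add, Nat.cast_smul_eq_nsmul, Nat.cast_smul_eq_nsmul, map_nsmul, map_nsmul] at key
  -- key : λ R₀ + u • λ(σ^h y) - (m+2h) • λ t = 0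
  rw [← sub_eq_zero, ← key]
  abel

/-- **A∞′ ⟹ the boundary bit is a multiple of `λ(y_K)`.**  If the `τ`-real value lies on the component of `y₀`
(`λ(σ^h • y) = λ y₀`, conjecture A∞′) and `t = v • y₀` (`h_K = 1`: `Tr y_ℓ = a_ℓ y_K`, `t = (a_ℓ/2^M) y_K`), then
`λ R₀ = (−u + (m + 2h) v) • λ y₀`. [cite: McCallumLMS1991, §5] -/
theorem apply_root_eq_zsmul_of_A {σ σ' : R} {m h e u : ℕ} (hσσ' : σ * σ' = 1)
    (hσ : σ ^ m = 1) (hm : m = 2 ^ e * u) (τ : M →+ M) (hτ : ∀ x : M, τ (σ • x) = σ' • τ x) {y t R₀ y₀ : M}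
    (hy : τ y = σ ^ (2 * h) • y) (ht : (∑ i ∈ range m, σ ^ i) • y = ((2 ^ e : ℕ) : R) • t)
    (h2 : ∀ x : M, ((2 ^ e : ℕ) : R) • x = 0 → x = 0)
    (hR₀ : ((2 ^ e : ℕ) : R) • R₀ =
      (∑ i ∈ range m, (i : R) * σ ^ i) • y + τ ((∑ i ∈ range m, (i : R) * σ ^ i) • y))
    (lam : M →+ A) (hlam : ∀ x : M, lam (x + τ x) = 0) (hA : lam (σ ^ h • y) = lam y₀) {v : ℤ}
    (htv : t = v • y₀) :
    lam R₀ = (-(u : ℤ) + ((m + 2 * h : ℕ) : ℤ) * v) • lam y₀ := by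
  rw [apply_root_of_even hσσ' hσ hm τ hτ hy ht h2 hR₀ lam hlam, hA, htv, map_zsmul]
  conv_rhs => rw [add_smul, neg_smul, mul_smul, natCast_zsmul, natCast_zsmul]

/-- **… and it VANISHES in the `M₀ ≥ 1` regime.**  If `y₀ ∈ 2 • M + N_τ M` (`y_K = 2 w + (x + τ x)`: the Heegner point is
`2`-divisible up to a `τ`-norm — e.g. `y_K ∈ 2 E(K) + E(K)_{odd tors}` read at the real place, where norms from `E(K) ⊂ E(ℂ)`
land in `E(ℝ)⁰`), then `λ y₀ = 0`, hence under A∞′ the boundary-level bit `λ R₀` is `0` (kit T2: `c = 0` in 621/621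
habitat rows with `M₀ ≥ 1`; the `c = 1` rows of T1 all have `M₀ = 0`). [cite: McCallumLMS1991, §5] -/
theorem apply_eq_zero_of_two_smul_add_norm (τ : M →+ M) (lam : M →+ A) (hlam : ∀ x : M, lam (x + τ x) = 0)
    {y₀ w x : M} (hw : τ w = w) (hy₀ : y₀ = 2 • w + (x + τ x)) : lam y₀ = 0 := by
  rw [hy₀, map_add, hlam, add_zero, map_nsmul, two_smul_apply_eq_zero τ lam hlam hw]

/-- The two previous statements combined: A∞′ + `t ∈ ℤ y₀` + `y₀ ∈ 2•(τ-fixed) + N_τ` ⟹ `λ R₀ = 0`.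
[cite: McCallumLMS1991, §5] -/
theorem apply_root_eq_zero_of_A {σ σ' : R} {m h e u : ℕ} (hσσ' : σ * σ' = 1)
    (hσ : σ ^ m = 1) (hm : m = 2 ^ e * u) (τ : M →+ M) (hτ : ∀ x : M, τ (σ • x) = σ' • τ x) {y t R₀ y₀ w x : M}
    (hy : τ y = σ ^ (2 * h) • y) (ht : (∑ i ∈ range m, σ ^ i) • y = ((2 ^ e : ℕ) : R) • t)
    (h2 : ∀ x : M, ((2 ^ e : ℕ) : R) • x = 0 → x = 0)
    (hR₀ : ((2 ^ e : ℕ) : R) • R₀ =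
      (∑ i ∈ range m, (i : R) * σ ^ i) • y + τ ((∑ i ∈ range m, (i : R) * σ ^ i) • y))
    (lam : M →+ A) (hlam : ∀ x : M, lam (x + τ x) = 0) (hA : lam (σ ^ h • y) = lam y₀) {v : ℤ}
    (htv : t = v • y₀) (hw : τ w = w) (hy₀ : y₀ = 2 • w + (x + τ x)) : lam R₀ = 0 := by
  rw [apply_root_eq_zsmul_of_A hσσ' hσ hm τ hτ hy ht h2 hR₀ lam hlam hA htv,
    apply_eq_zero_of_two_smul_add_norm τ lam hlam hw hy₀, smul_zero]

end Boundary

/-! ## §5 Independence: the relations do not decide the bottom step -/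

/-- **A∞′ is NOT a consequence of the relations.**  A two-element model (`M = A = ℤ/2`, `σ = ρ = 1`, `τ = id`, `λ = id`,
`a = 2`, `m = 4`, `q = 3`): every hypothesis used above holds — `λ` kills `τ`-norms, all values are `τ`-fixed, the bottom trace
relation `Σ_{i<m} σ^i • y₁ = a • y₀`, the vertical relation `Σ_{i<q} ρ^i • z₂ = a • y₁ − y₀` — and yet
`λ y₁ ≠ λ y₀`.  So the equality of real components at conductor `ℓ` and conductor `1` (A∞′, 747/747 in the kit's data) needs
input beyond the Heegner-module relations at the real place. [folklore] -/
theorem exists_model_layerOne_ne_layerZero :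
    ∃ (y₀ y₁ z₂ : ZMod 2) (τ lam : ZMod 2 →+ ZMod 2),
      (∀ x, lam (x + τ x) = 0) ∧ τ y₀ = y₀ ∧ τ y₁ = y₁ ∧ τ z₂ = z₂ ∧
      (∑ i ∈ range 4, (1 : ℤ) ^ i • y₁ = (2 : ℤ) • y₀) ∧
      (∑ i ∈ range 3, (1 : ℤ) ^ i • z₂ = (2 : ℤ) • y₁ - y₀) ∧
      lam y₁ ≠ lam y₀ := by
  refine ⟨0, 1, 0, AddMonoidHom.id _, AddMonoidHom.id _, ?_, rfl, rfl, rfl, ?_, ?_, ?_⟩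
  · intro x
    simp only [AddMonoidHom.id_apply]
    fin_cases x <;> decide
  · simp only [sum_range_succ, sum_range_zero, one_pow, one_smul, smul_zero]
    decide
  · simp only [sum_range_succ, sum_range_zero, one_pow, one_smul, sub_zero]
    decide
  · decide

end Summit.BirchSwinnertonDyer.BirchSwinnertonDyer.Theorems.OffBigImageOddLocalAtTwo.ArchVerticalNorm
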